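import Mathlib
import HarnessLib
import Summits.HubbardSuperconductivity.HubbardSuperconductivity.Theorems.KLProgrammeH10TwoPointLimitIsoTorusRates
import Summits.HubbardSuperconductivity.HubbardSuperconductivity.Theorems.KLProgrammeH10TwoPointLimitSectorMultiplierRates
import Summits.HubbardSuperconductivity.HubbardSuperconductivity.Theorems.KLProgrammeH10TwoPointLimitSectorMultiplierOverlapRegime
import Summits.HubbardSuperconductivity.HubbardSuperconductivity.Theorems.KLProgrammeKLRegimeEngineScaleZeroOverlapL1
import Summits.HubbardSuperconductivity.HubbardSuperconductivity.Theorems.KLProgrammeH10TwoPointLimitFramePerturbation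
import Summits.HubbardSuperconductivity.HubbardSuperconductivity.Theorems.KLProgrammeKLRegimeSplitThermalLayerExt
import Summits.HubbardSuperconductivity.HubbardSuperconductivity.Theorems.KLProgrammeKLRegimeEngineIsoTorusDefs
import Summits.HubbardSuperconductivity.HubbardSuperconductivity.Theorems.KLProgrammeKLRegimeEngineSymbolThresholds
import Summits.HubbardSuperconductivity.HubbardSuperconductivity.Theorems.KLProgrammeKLRegimeEngineThresholdBridges

/-!
# Route `KLProgramme` — engine support, route (L2): the ISOTROPIC single-family torus bound `T̂_iso` — the hypothesis `hT` of
# `EngineV8.isoTupleL1AtS_zero_of_klEng` ((E5-S)₀ of `stub_engine_scale0`, ENGINE item stmt-HubbardSuperconductivity-19918),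
# uniform in the scale `m`, with ONE absolute constant for every admissible frame

Cell `gate-hubbard-kl`, seat p4 (C5a lead), g7; plan g13 GO «p4: type T̂_iso» (J3b, final).  For `F = klIsoFamily L M β μ K e₀ m`:

* (pure-real bookkeeping `iso_bracket_le`, `iso_supp_le`, `iso_assemble` and the INACTIVE-scale vanishing
  `klIsoFamily_eq_zero_of_klScale_lt` — `Λ_m < π/β ≤ |k₀|` for `m > n_β` — live in `…IsoTorusRates`);
* §1 `iso_torusSum_le_frame` (frame-keyed, ACTIVE scales `π/(4β) ≤ Λ_m`): k3c2-p1's `EngineV8.torusSum_le_of_symbol_bounds` on the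
  `4M`-padded grid at the rates `s₀ = 2Λ_mβ/(4M·π√c_G)`, `s₁ = 2Λ_m/(π√κ₁)` and `N_s = ⌊(Λ_mβ/π+1)·#cell⌋₊`, fed with the pack of
  `…IsoSymbolDiffs`; sizes `1/s₀ + 1 ≤ (2M/(Λβ))(π√c_G+1)`, near + far `≤ κ_X/Λ²`, `N_s ≤ (5Λβ/π)(LΛ)²c_N` (the iso cell is `r̄Λ_m`),
  so `(1/(|β|L²))·Σ_{dw}‖Σ_k F ω k·Χ_c(k;dw)‖ ≤ √(2048(π√c_G+1)κ_X(640/π)c_N)·M/β`, explicit in `(d, e₀, A, B_a, s_max, Dt_min, ρ_min)`;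
* §2 **`iso_torusSum_of_frameOK`** — `∃ κ₀ > 0, ∃ T̂ > 0, ∀ R (Gfr ≥ 0), ∀ 0 < c ≤ κ₀/(12(Gfr₂+1)), ∀ 0 < U ≤ min 1 (κ₀/(24(Gfr₀+Gfr₁+1))),
  ∀ β ∈ [klBetaMin, e^{c/U²}], ∀ μ ∈ klWindowC, ∀ K, FrameOK R U (nScales β) μ K → ∀ L M [NeZero], β² ≤ L → β ≤ M → ∀ m ω c,
  (1/(|β|L²))·Σ_{dw}‖Σ_k klIsoFamily L M β μ K klE0 m ω k · Χ_c(k;dw)‖ ≤ T̂ / imagTimeWeight β M` — p3's `hT` with `Th := T̂` a CLOSED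
  constant (no staged binder; it depends only on the cutoff-profile constants `d`, `B_a`, the `bandBounds(−6/5,−1/10)` numerals and `klE0`);
  `T̂ = √(2048(π√c_G+1)κ_X(640/π)c_N)/2` at `A = κ₀/4`, since `imagTimeWeight β M = β/(2M)`; `iso_torusSum_of_thresholds` is the same
  with `κ₀ = min (min (Dt_min/4) (ρ_min/4)) (1/40)` of `bandBounds (−6/5) (−1/10)` EXPOSED (so that the engine's threshold bridges apply);
* §3 **`exists_isoTorusBoundAt : ∃ T, 0 ≤ T ∧ EngineV8.IsoTorusBoundAt T`** and **`isoTorusBoundAt_klIsoT : IsoTorusBoundAt klIsoT`** —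
  p3 g6's NAMED target (…EngineIsoTorusDefs) under EXACTLY the binders of `stub_engine_scale0`, via k3c2-p3's
  `klEngC₃3_le_symbolC₃` / `klEngU₀3_le_symbolU₀` / `gfr_nonneg_of_wf2` (…EngineSymbolThresholds) and p3's `sq_le_of_klEngL₃_le` /
  `le_of_klEngM₃_le` (…EngineThresholdBridges).

Everything is proved; no definitions, no named facts. [cite: BenfattoGiulianiMastropietro2006, §2.5 (2.57), §2.6 (2.81), §2.8 (2.77)]
-/

noncomputable section

namespace Summit.HubbardSuperconductivity.HubbardSuperconductivity.Theorems.TorusFourierL2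

set_option linter.dupNamespace false -- summit = problem name (single-conjunct summit), D-0017

open Set Finset Literature.MathematicalPhysics.QuantumLattice Literature.MathematicalPhysics.QuantumLattice.BandSectorCounting
open Literature.MathematicalPhysics.QuantumLattice.FermiRG Literature.Probability.LatticeModels Literature.Analysis.SpecialFunctions
open Summit.HubbardSuperconductivity.HubbardSuperconductivity.Theorems.DispersionFlow
open Summit.HubbardSuperconductivity.HubbardSuperconductivity.Theorems.KLRegimeSplit
open Summit.HubbardSuperconductivity.HubbardSuperconductivity.Theorems.KLProgrammeLegKernels
open Summit.HubbardSuperconductivity.HubbardSuperconductivity.Theorems.PerturbedFermiCurve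
open scoped Real ComplexConjugate

/-! ### §1 The frame-keyed bound at an active scale -/

section Frame

variable {L M : ℕ} [NeZero L] [NeZero M] {a b : ℝ} (B : BandBounds a b) {K : TrigPolyC4v} {A : ℝ}
  (hA : ∀ p : Momentum, ∀ j ≤ 2, ‖iteratedFDeriv ℝ j (frameShift K) p‖ ≤ A) (hADt : 2 * A < B.Dtmin)
  {μ e₀ z β : ℝ} (he : 0 < e₀) (hz : 0 < z) (hz1 : z ≤ 1) (hgap : e₀ + A + z ^ 2 < -μ) (h3 : e₀ + A - μ ≤ 3)
  (hlo : a ≤ μ - A - e₀) (hhi : μ + A + e₀ ≤ b) (hβ : 0 < β) (hρA : 4 * A < 2 * B.rhomin)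
  {d : ℝ} (hd : 0 < d) (hd1 : ∀ u, |deriv (bgmCutoffSq e₀) u| ≤ d) (hd2 : ∀ u, |iteratedDeriv 2 (bgmCutoffSq e₀) u| ≤ d)
  {Ba : ℝ} (hB0 : 0 < Ba)
  (hB : ∀ (i : ℕ), i ≤ 2 → ∀ (n : ℕ) (ω : ℤ) (θ₀ : ℝ) (q w : Fin 2 → ℝ) (t : ℝ) {r₀ : ℝ}, 0 < r₀ →
    r₀ ≤ ‖momToComplex (q + t • w)‖ → |sectorRelAngle θ₀ (q + t • w)| < π →
    ‖iteratedDeriv i (fun t : ℝ => sectorWeightCirc n ω (polarAngle (q + t • w))) t‖ ≤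
      (2 : ℕ).factorial * Ba * ((1 + (sectorWidth n)⁻¹ * (2 : ℕ).factorial) * ‖momToComplex w‖ / r₀) ^ i)
  {cG r Y κ₁ κX cN : ℝ}
  (hcG : cG = 4 * (d * e₀ ^ 4) + 2 * (d * e₀ ^ 2))
  (hr : r = (1 + 3 * π * B.smax * B.Dtmin / (4 * e₀)) / (B.Dtmin - 2 * A))
  (hY : Y = (4 + 2 * A) + (4 + 4 * A) * (r * e₀ + 1))
  (hκ₁ : κ₁ = cG * Y ^ 2 + 2 * (d * e₀ ^ 2) * (4 + 4 * A) * e₀ + 16 * (d * e₀ ^ 2) * Ba * Y * e₀ + 8 * Ba * e₀ ^ 2)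
  (hκX : κX = 4 * (Real.sqrt 2 * π * Real.sqrt κ₁ + 2 * e₀) ^ 2 + 16 * (π * Real.sqrt κ₁ / 2 + e₀) ^ 2)
  (hcN : cN = (Real.sqrt 2 * (1 + (4 + 4 * A) * r ^ 2 * e₀) / ((2 * B.rhomin - 4 * A) * π) + 2) *
    (2 * Real.sqrt 2 * r / π + 2))

set_option maxHeartbeats 800000 in -- the explicit constants have a few dozen atoms; the torus-sum lemma has five large hypotheses
include B hA hADt he hz hz1 hgap h3 hlo hhi hβ hρA hd hd1 hd2 hB0 hB hcG hr hY hκ₁ hκX hcN in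
/-- **The isotropic torus bound on an admissible frame at an active scale** (`π/(4β) ≤ Λ_m`, `Λ_mβ < π(2M−3)`, `βe₀ ≤ M`, `1 ≤ LΛ_m`,
`2|2π/L| ≤ z`): for every sector `ω` and charge `c`,
`(1/(|β|L²))·Σ_{dw}‖Σ_k F ω k·Χ_c(k;dw)‖ ≤ √(2048(π√c_G+1)κ_X·(640/π)c_N)·M/β`. [cite: BenfattoGiulianiMastropietro2006, §2.6 (2.81)] -/
theorem iso_torusSum_le_frame {m : ℕ} (hM : klScale e₀ m * β < π * (2 * M - 3)) (hM1 : 1 ≤ M) (hMβ : β * e₀ ≤ M)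
    (hLz : 2 * |2 * π / (L : ℝ)| * 1 ≤ z) (hLΛ : 1 ≤ (L : ℝ) * klScale e₀ m) (hΛβ : π / (4 * β) ≤ klScale e₀ m)
    (ω : Fin (sectorCount (2 * m))) (c : Fin 2) :
    1 / (|β| * (L : ℝ) ^ 2) * ∑ dw : TorusSite 1 (2 * (2 * M)) × TorusSite 2 L, ‖∑ k : FreqMomentum L M,
        klIsoFamily L M β μ K e₀ m ω k *
          (if c = 0 then torusChar (fun _ : Fin 1 => ((k.1 : ℕ) : ZMod (2 * (2 * M)))) dw.1 * torusChar k.2 dw.2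
            else conj (torusChar (fun _ : Fin 1 => ((k.1 : ℕ) : ZMod (2 * (2 * M)))) dw.1 * torusChar k.2 dw.2))‖ ≤
      Real.sqrt (2048 * (π * Real.sqrt cG + 1) * κX * (640 / π * cN)) * M / β := by
  classical
  have hL : (0 : ℝ) < L := Nat.cast_pos.2 (Nat.pos_of_ne_zero (NeZero.ne L))
  have hM0 : 0 < M := Nat.pos_of_ne_zero (NeZero.ne M)
  have hMpos : (0 : ℝ) < M := Nat.cast_pos.2 hM0
  have hP0 : (0 : ℝ) < ((2 * (2 * M) : ℕ) : ℝ) := by positivity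
  have hP : ((2 * (2 * M) : ℕ) : ℝ) = 2 * (2 * (M : ℝ)) := by push_cast; ring
  have hπ := Real.pi_pos
  have hA0 : 0 ≤ A := le_trans (norm_nonneg _) (hA 0 0 (by norm_num))
  have hDt : 0 < B.Dtmin - 2 * A := by linarith
  have hγ : 0 < 2 * B.rhomin - 4 * A := by linarith
  have hsm := B.smax_pos
  have hDt0 := B.Dtmin_pos
  have hΛ : 0 < klScale e₀ m := by rw [klScale]; positivity
  have hΛe : klScale e₀ m ≤ e₀ := klScale_le_e0 he.le m
  have hcG0 : 0 < cG := by rw [hcG]; positivity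
  have hr0 : 0 ≤ r := by rw [hr]; positivity
  have hY0 : 0 ≤ Y := by rw [hY]; positivity
  have hκ0 : 0 < κ₁ := by rw [hκ₁]; positivity
  have hκX0 : 0 < κX := by rw [hκX]; positivity
  have hcN0 : 0 < cN := by rw [hcN]; positivity
  -- `Λβ ≤ 2M`, the iso cell radius is `r̄Λ`
  have hΛβM : klScale e₀ m * β ≤ 2 * M := by
    have := mul_le_mul_of_nonneg_right hΛe hβ.le
    linarith
  have hw2m : sectorWidth (2 * m) = π * klScale e₀ m / e₀ := by
    rw [sectorWidth, klScale, pow_mul]; field_simp; norm_num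
  have hρeq : (klScale e₀ m + B.smax * B.Dtmin * (3 * sectorWidth (2 * m) / 4)) / (B.Dtmin - 2 * A) = r * klScale e₀ m := by
    rw [hr, hw2m, div_mul_eq_mul_div, div_eq_iff hDt.ne', div_mul_cancel₀ _ hDt.ne']
    field_simp
  -- the support count as a real and as a natural number
  obtain ⟨X, hX⟩ : ∃ X : ℝ, X = (klScale e₀ m * β / π + 1) *
      ((Real.sqrt 2 * L * ((klScale e₀ m + (4 + 4 * A) *
          ((klScale e₀ m + B.smax * B.Dtmin * (3 * sectorWidth (2 * m) / 4)) / (B.Dtmin - 2 * A)) ^ 2) /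
            (2 * B.rhomin - 4 * A)) / π + 2) *
        (Real.sqrt 2 * L * (2 * ((klScale e₀ m + B.smax * B.Dtmin * (3 * sectorWidth (2 * m) / 4)) / (B.Dtmin - 2 * A))) /
          π + 2)) := ⟨_, rfl⟩
  have hX0 : 0 ≤ X := by
    rw [hX]; have := sectorWidth_pos (2 * m); positivity
  have hXle : X ≤ 5 * klScale e₀ m * β / π * ((L : ℝ) * klScale e₀ m) ^ 2 * cN := by
    rw [hX, hcN]
    exact iso_supp_le (K₂ := 4 + 4 * A) (γ := 2 * B.rhomin - 4 * A) hΛ hβ hL hρeq hr0 (by positivity) hγ hLΛ hΛβ hΛe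
  have hNs : ((⌊X⌋₊ : ℕ) : ℝ) ≤ 5 * klScale e₀ m * β / π * ((L : ℝ) * klScale e₀ m) ^ 2 * cN := (Nat.floor_le hX0).trans hXle
  -- the symbol data of every isotropic sector at scale `m`
  have hG : ∀ ω' : Fin (sectorCount (2 * m)), ∃ Z' : (Fin 2 → ℝ) → ℝ, ∃ Φ' : ℝ × (Fin 2 → ℝ) → ℂ,
      (∀ p, Z' p = gnCutoff ((π + z) ^ 2 / π ^ 2) ((π + z) ^ 2) (p 0 ^ 2) * gnCutoff ((π + z) ^ 2 / π ^ 2) ((π + z) ^ 2) (p 1 ^ 2) *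
        (radialCutoffC (1 / 2) (momToComplex p) * sectorWeightCirc (2 * m) ((ω' : ℕ) : ℤ) (polarAngle p))) ∧
      (∀ k₀ p, Φ' (k₀, p) =
        ((bgmCutoffSq e₀ ((16 : ℝ) ^ m * (k₀ ^ 2 + frameLevel μ K (WithLp.toLp 2 p) ^ 2)) * Z' p : ℝ) : ℂ)) := by
    intro ω'
    refine ⟨fun p => gnCutoff ((π + z) ^ 2 / π ^ 2) ((π + z) ^ 2) (p 0 ^ 2) * gnCutoff ((π + z) ^ 2 / π ^ 2) ((π + z) ^ 2) (p 1 ^ 2) *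
      (radialCutoffC (1 / 2) (momToComplex p) * sectorWeightCirc (2 * m) ((ω' : ℕ) : ℤ) (polarAngle p)),
      fun kp => ((bgmCutoffSq e₀ ((16 : ℝ) ^ m * (kp.1 ^ 2 + frameLevel μ K (WithLp.toLp 2 kp.2) ^ 2)) *
        (gnCutoff ((π + z) ^ 2 / π ^ 2) ((π + z) ^ 2) (kp.2 0 ^ 2) * gnCutoff ((π + z) ^ 2 / π ^ 2) ((π + z) ^ 2) (kp.2 1 ^ 2) *
          (radialCutoffC (1 / 2) (momToComplex kp.2) * sectorWeightCirc (2 * m) ((ω' : ℕ) : ℤ) (polarAngle kp.2))) : ℝ) : ℂ),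
      fun _ => rfl, fun _ _ => rfl⟩
  -- the torus-sum lemma at the isotropic rates
  have main := EngineV8.torusSum_le_of_symbol_bounds (L := L) (M := M) β (klIsoFamily L M β μ K e₀ m)
    (conj_klIsoFamily β μ K e₀ m) (norm_klIsoFamily_le_one β μ K e₀ m)
    (s₀ := 2 * klScale e₀ m * β / (((2 * (2 * M) : ℕ) : ℝ) * π * Real.sqrt cG))
    (s₁ := 2 * klScale e₀ m / (π * Real.sqrt κ₁)) (by positivity) (by positivity) (Nsupp := ⌊X⌋₊)
    (fun ω' => by
      obtain ⟨Z', Φ', hZ', hΦ'⟩ := hG ω'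
      exact Nat.le_floor ((card_support_isoPadded_le B hA hADt he hz hz1 hgap h3 hlo hhi hβ hρA ω' hd1 hd2 hZ' hΦ'
        (Gs := fun q : TorusSite 1 (2 * (2 * M)) × TorusSite 2 L =>
          if h : (q.1 0).val < 2 * M then klIsoFamily L M β μ K e₀ m ω' (⟨(q.1 0).val, h⟩, q.2) else 0)
        (fun _ => rfl) hM).trans (le_of_eq hX.symm)))
    (fun ω' q => by
      obtain ⟨Z', Φ', hZ', hΦ'⟩ := hG ω'
      have h := norm_fwdDiff_two_time_isoPadded_le hA he hz h3 hβ ω' hd.le hd1 hd2 hZ' hΦ'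
        (Gs := fun q : TorusSite 1 (2 * (2 * M)) × TorusSite 2 L =>
          if h : (q.1 0).val < 2 * M then klIsoFamily L M β μ K e₀ m ω' (⟨(q.1 0).val, h⟩, q.2) else 0)
        (fun _ => rfl) hM hM1 q
      have e := rate_time_sq (P := ((2 * (2 * M) : ℕ) : ℝ)) hcG0 hΛ hβ hP0
      rw [one_mul] at e
      rw [e, hcG]
      exact h)
    (fun ω' q i => by
      obtain ⟨Z', Φ', hZ', hΦ'⟩ := hG ω'
      have h := norm_fwdDiff_two_axis_isoPadded_le B hA hADt he hz hz1 hgap h3 hlo hhi hβ ω' hd.le hd1 hd2 hZ' hΦ'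
        (Gs := fun q : TorusSite 1 (2 * (2 * M)) × TorusSite 2 L =>
          if h : (q.1 0).val < 2 * M then klIsoFamily L M β μ K e₀ m ω' (⟨(q.1 0).val, h⟩, q.2) else 0)
        (fun _ => rfl) hB0.le hB hM hLz q i
      have e := rate_space_sq hκ0 hΛ hL
      rw [one_mul] at e
      rw [e]
      refine h.trans (le_of_eq ?_)
      rw [hκ₁, hcG, hY, hr]
      ring)
    ω c
  refine main.trans ?_
  rw [hP]
  have htfac := tfac_le (M := 2 * (M : ℝ)) hcG0 hΛ hβ (by positivity) hΛβM
  have hbr := iso_bracket_le hκ0 hΛ hΛe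
  rw [← hκX] at hbr
  refine iso_assemble hΛ hβ hMpos hL hκX0.le hcN0.le (by positivity) (by positivity) ?_ ?_
  · exact mul_le_mul (mul_le_mul_of_nonneg_left htfac (by norm_num)) hbr (by positivity) (by positivity)
  · exact mul_le_mul_of_nonneg_left hNs (by positivity)

end Frame

/-! ### §2 The bound in the KL regime, on every admissible frame, with one absolute constant -/

set_option maxHeartbeats 400000 in -- a long regime bookkeeping proof with two dozen named constants
/-- **The regime-keyed isotropic torus bound with the ABSOLUTE threshold `κ₀ = min (min (Dt_min/4) (ρ_min/4)) (1/40)` EXPOSED**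
(`B = bandBounds (−6/5) (−1/10)`): there is `T̂ > 0` such that for every `R` (`Gfr ≥ 0`), `0 < c ≤ κ₀/(12(Gfr₂+1))`,
`0 < U ≤ min 1 (κ₀/(24(Gfr₀+Gfr₁+1)))`, `klBetaMin ≤ β ≤ e^{c/U²}`, `μ ∈ klWindowC`, `FrameOK R U (nScales β) μ K`, `β² ≤ L`, `β ≤ M` and every
`m, ω, c`: `(1/(|β|L²))·Σ_{dw}‖Σ_k klIsoFamily L M β μ K klE0 m ω k·Χ_c(k;dw)‖ ≤ T̂ / imagTimeWeight β M`.
[cite: BenfattoGiulianiMastropietro2006, §2.6 (2.81), §2.8 (2.77)] -/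
theorem iso_torusSum_of_thresholds (ha : (-4 : ℝ) < -(6 / 5)) (hab : (-(6 / 5) : ℝ) ≤ -(1 / 10)) (hb : (-(1 / 10) : ℝ) < 0) :
    ∃ Th : ℝ, 0 < Th ∧ ∀ (R : RenConsts), (∀ j, 0 ≤ R.Gfr j) →
      ∀ (c U : ℝ), 0 < c →
      c ≤ min (min ((bandBounds ha hab hb).Dtmin / 4) ((bandBounds ha hab hb).rhomin / 4)) (1 / 40) / (12 * (R.Gfr 2 + 1)) → 0 < U →
      U ≤ min 1 (min (min ((bandBounds ha hab hb).Dtmin / 4) ((bandBounds ha hab hb).rhomin / 4)) (1 / 40) / (24 * (R.Gfr 0 + R.Gfr 1 + 1))) →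
      ∀ β : ℝ, klBetaMin ≤ β → β ≤ Real.exp (c / U ^ 2) → ∀ μ ∈ klWindowC, ∀ K : TrigPolyC4v, FrameOK R U (nScales β) μ K →
      ∀ (L M : ℕ) [NeZero L] [NeZero M], β ^ 2 ≤ (L : ℝ) → β ≤ (M : ℝ) →
      ∀ (m : ℕ) (ω : Fin (sectorCount (2 * m))) (ch : Fin 2),
        1 / (|β| * (L : ℝ) ^ 2) * ∑ dw : TorusSite 1 (2 * (2 * M)) × TorusSite 2 L, ‖∑ k : FreqMomentum L M,
          klIsoFamily L M β μ K klE0 m ω k *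
            (if ch = 0 then torusChar (fun _ : Fin 1 => ((k.1 : ℕ) : ZMod (2 * (2 * M)))) dw.1 * torusChar k.2 dw.2
              else conj (torusChar (fun _ : Fin 1 => ((k.1 : ℕ) : ZMod (2 * (2 * M)))) dw.1 * torusChar k.2 dw.2))‖ ≤
          Th / imagTimeWeight β M := by
  -- the window band bounds and the absolute frame-size threshold (as in `overlap_sums_klAniso_bgmFat_of_frameOK`)
  set B : BandBounds (-(6 / 5)) (-(1 / 10)) := bandBounds ha hab hb with hBdef
  set κ₀ : ℝ := min (min (B.Dtmin / 4) (B.rhomin / 4)) (1 / 40) with hκ₀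
  have hDt := B.Dtmin_pos
  have hrh := B.rhomin_pos
  have hκ₀pos : 0 < κ₀ := by rw [hκ₀]; exact lt_min (lt_min (by positivity) (by positivity)) (by norm_num)
  have hκ₀Dt : κ₀ ≤ B.Dtmin / 4 := (min_le_left _ _).trans (min_le_left _ _)
  have hκ₀rh : κ₀ ≤ B.rhomin / 4 := (min_le_left _ _).trans (min_le_right _ _)
  have hκ₀40 : κ₀ ≤ 1 / 40 := min_le_right _ _
  -- the cutoff constants
  have he : (0 : ℝ) < klE0 := by norm_num [klE0]
  obtain ⟨d₀, hd₀, hd₀1, hd₀2⟩ := exists_abs_derivs_bgmCutoffSq_le he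
  obtain ⟨B₀, hB₀0, hB₀⟩ := exists_norm_iteratedDeriv_sectorWeightCirc_polarAngle_line_le 2
  have hd : (0 : ℝ) < d₀ + 1 := by linarith
  have hd1 : ∀ u, |deriv (bgmCutoffSq klE0) u| ≤ d₀ + 1 := fun u => (hd₀1 u).trans (by linarith)
  have hd2 : ∀ u, |iteratedDeriv 2 (bgmCutoffSq klE0) u| ≤ d₀ + 1 := fun u => (hd₀2 u).trans (by linarith)
  have hBa : (0 : ℝ) < B₀ + 1 := by linarith
  have hB : ∀ (i : ℕ), i ≤ 2 → ∀ (n : ℕ) (ω : ℤ) (θ₀ : ℝ) (q w : Fin 2 → ℝ) (t : ℝ) {r₀ : ℝ}, 0 < r₀ →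
      r₀ ≤ ‖momToComplex (q + t • w)‖ → |sectorRelAngle θ₀ (q + t • w)| < π →
      ‖iteratedDeriv i (fun t : ℝ => sectorWeightCirc n ω (polarAngle (q + t • w))) t‖ ≤
        (2 : ℕ).factorial * (B₀ + 1) * ((1 + (sectorWidth n)⁻¹ * (2 : ℕ).factorial) * ‖momToComplex w‖ / r₀) ^ i := by
    intro i hi n ω θ₀ q w t r₀ hr₀ hr hθ
    refine (hB₀ i hi n ω θ₀ q w t hr₀ hr hθ).trans ?_
    have hX : 0 ≤ ((1 + (sectorWidth n)⁻¹ * (2 : ℕ).factorial) * ‖momToComplex w‖ / r₀) ^ i := by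
      have := sectorWidth_pos n; positivity
    have h2 : (0 : ℝ) ≤ (2 : ℕ).factorial := Nat.cast_nonneg _
    nlinarith [mul_nonneg h2 hX]
  -- the absolute constants
  set A : ℝ := κ₀ / 4 with hAdef
  have hA0 : 0 < A := by rw [hAdef]; positivity
  have hDtA : 0 < B.Dtmin - 2 * A := by rw [hAdef]; linarith
  have hrhA : 0 < 2 * B.rhomin - 4 * A := by rw [hAdef]; linarith
  have hsm := B.smax_pos
  have hπ := Real.pi_pos
  obtain ⟨cG, hcG⟩ : ∃ cG : ℝ, cG = 4 * ((d₀ + 1) * klE0 ^ 4) + 2 * ((d₀ + 1) * klE0 ^ 2) := ⟨_, rfl⟩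
  obtain ⟨r, hr⟩ : ∃ r : ℝ, r = (1 + 3 * π * B.smax * B.Dtmin / (4 * klE0)) / (B.Dtmin - 2 * A) := ⟨_, rfl⟩
  obtain ⟨Y, hY⟩ : ∃ Y : ℝ, Y = (4 + 2 * A) + (4 + 4 * A) * (r * klE0 + 1) := ⟨_, rfl⟩
  obtain ⟨κ₁, hκ₁⟩ : ∃ κ₁ : ℝ, κ₁ = cG * Y ^ 2 + 2 * ((d₀ + 1) * klE0 ^ 2) * (4 + 4 * A) * klE0 +
      16 * ((d₀ + 1) * klE0 ^ 2) * (B₀ + 1) * Y * klE0 + 8 * (B₀ + 1) * klE0 ^ 2 := ⟨_, rfl⟩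
  obtain ⟨κX, hκX⟩ : ∃ κX : ℝ, κX = 4 * (Real.sqrt 2 * π * Real.sqrt κ₁ + 2 * klE0) ^ 2 +
      16 * (π * Real.sqrt κ₁ / 2 + klE0) ^ 2 := ⟨_, rfl⟩
  obtain ⟨cN, hcN⟩ : ∃ cN : ℝ, cN = (Real.sqrt 2 * (1 + (4 + 4 * A) * r ^ 2 * klE0) / ((2 * B.rhomin - 4 * A) * π) + 2) *
      (2 * Real.sqrt 2 * r / π + 2) := ⟨_, rfl⟩
  have hr0 : 0 ≤ r := by rw [hr]; positivity
  have hcG0 : 0 < cG := by rw [hcG]; positivity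
  have hY0 : 0 ≤ Y := by rw [hY]; positivity
  have hκ0 : 0 < κ₁ := by rw [hκ₁]; positivity
  have hκX0 : 0 < κX := by rw [hκX]; positivity
  have hcN0 : 0 < cN := by rw [hcN]; positivity
  have hS0 : 0 < Real.sqrt (2048 * (π * Real.sqrt cG + 1) * κX * (640 / π * cN)) := Real.sqrt_pos.2 (by positivity)
  refine ⟨Real.sqrt (2048 * (π * Real.sqrt cG + 1) * κX * (640 / π * cN)) / 2, by positivity, ?_⟩
  intro R hR c U hc hcle hU hUle β hβmin hβc μ hμ K hK L M _ _ hLβ hMβ m ω ch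
  have hβ0 : 0 < β := pos_of_klBetaMin_le hβmin
  have hβ128 : 128 ≤ β := by simpa [klBetaMin] using hβmin
  have hM0 : 0 < M := Nat.pos_of_ne_zero (NeZero.ne M)
  have hMpos : (0 : ℝ) < M := Nat.cast_pos.2 hM0
  have hL0 : (0 : ℝ) < L := lt_of_lt_of_le (by positivity) hLβ
  have hε : 0 < imagTimeWeight β M := by rw [imagTimeWeight]; positivity
  rcases le_or_gt m (nScales β + 1) with hmN | hmN
  · -- ACTIVE scale: the frame's `C²` size is `≤ A = κ₀/4`
    have hlog : 1 ≤ Real.log 4 := by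
      have h4 : Real.exp 1 ≤ 4 := by have := Real.exp_one_lt_d9; norm_num at this; linarith
      calc (1 : ℝ) = Real.log (Real.exp 1) := (Real.log_exp 1).symm
        _ ≤ Real.log 4 := Real.log_le_log (Real.exp_pos 1) h4
    have hAK : ∀ p : Momentum, ∀ j ≤ 2, ‖iteratedFDeriv ℝ j (frameShift K) p‖ ≤ A := by
      intro p j hj
      refine (norm_iteratedFDeriv_frameShift_le_of_frameOK_regime hR hc.le hβmin hβc hK p hj).trans ?_
      have h0 := hR 0; have h1 := hR 1; have h2 := hR 2
      have hU1 : U ≤ 1 := hUle.trans (min_le_left _ _)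
      have hUk : U ≤ κ₀ / (24 * (R.Gfr 0 + R.Gfr 1 + 1)) := hUle.trans (min_le_right _ _)
      rw [abs_of_pos hU]
      have hU2 : U ^ 2 ≤ U := by nlinarith only [hU, hU1]
      have hA1 : 2 * R.Gfr 0 * U + 2 * R.Gfr 1 * U ^ 2 ≤ 2 * (R.Gfr 0 + R.Gfr 1 + 1) * U := by
        have := mul_le_mul_of_nonneg_left hU2 h1
        linarith only [this, hU.le]
      have hB1 : 2 * (R.Gfr 0 + R.Gfr 1 + 1) * U ≤ κ₀ / 12 := by
        have hpos : 0 < 24 * (R.Gfr 0 + R.Gfr 1 + 1) := by positivity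
        have := (le_div_iff₀ hpos).mp hUk
        linarith only [this]
      have hC1 : R.Gfr 2 * (c / Real.log 4) ≤ R.Gfr 2 * c := mul_le_mul_of_nonneg_left (div_le_self hc.le hlog) h2
      have hD1 : R.Gfr 2 * c ≤ κ₀ / 12 := by
        have hpos : 0 < 12 * (R.Gfr 2 + 1) := by positivity
        have := (le_div_iff₀ hpos).mp hcle
        linarith only [this, hc.le]
      rw [hAdef]; linarith only [hA1, hB1, hC1, hD1, hκ₀pos]
    -- the window margins
    have hμ' := hμ
    simp only [klWindowC, Set.mem_Icc] at hμ'
    have e1 : (-1.05 : ℝ) = -(21 / 20) := by norm_num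
    have e2 : (-0.15 : ℝ) = -(3 / 20) := by norm_num
    have hμlo : -(21 / 20 : ℝ) ≤ μ := by rw [← e1]; exact hμ'.1
    have hμhi : μ ≤ -(3 / 20 : ℝ) := by rw [← e2]; exact hμ'.2
    have he0 : klE0 = 1 / 32 := rfl
    have hgap : klE0 + A + (1 / 10 : ℝ) ^ 2 < -μ := by rw [he0, hAdef]; linarith only [hμhi, hκ₀40]
    have h3 : klE0 + A - μ ≤ 3 := by rw [he0, hAdef]; linarith only [hμlo, hκ₀40]
    have hlo : (-(6 / 5) : ℝ) ≤ μ - A - klE0 := by rw [he0, hAdef]; linarith only [hμlo, hκ₀40]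
    have hhi : μ + A + klE0 ≤ -(1 / 10) := by rw [he0, hAdef]; linarith only [hμhi, hκ₀40]
    have hADt : 2 * A < B.Dtmin := by rw [hAdef]; linarith
    have hρA : 4 * A < 2 * B.rhomin := by rw [hAdef]; linarith
    -- the scale thresholds
    obtain ⟨hM, hMβ', hLz, -, hΛβ⟩ := regime_scale_thresholds hβmin hLβ hMβ hmN
    have hLz' : 2 * |2 * π / (L : ℝ)| * 1 ≤ 1 / 10 := by
      have h1 : (1 : ℝ) ≤ (2 : ℝ) ^ m + 1 / 2 := by
        have := one_le_pow₀ (M₀ := ℝ) (a := 2) (by norm_num) (n := m)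
        linarith
      have h0 : 0 ≤ 2 * |2 * π / (L : ℝ)| := by positivity
      exact (mul_le_mul_of_nonneg_left h1 h0).trans hLz
    have hLΛ : 1 ≤ (L : ℝ) * klScale klE0 m := by
      have h1 : π / (4 * β) * β ^ 2 ≤ klScale klE0 m * L :=
        mul_le_mul hΛβ hLβ (by positivity) (klth_klScale_pos m).le
      have e : π / (4 * β) * β ^ 2 = π * β / 4 := by field_simp
      rw [e] at h1
      have h2 : (3 : ℝ) * 128 ≤ π * β := mul_le_mul Real.pi_gt_three.le hβ128 (by norm_num) Real.pi_pos.le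
      linarith
    have h := iso_torusSum_le_frame (L := L) (M := M) (μ := μ) (K := K) B hAK hADt he (by norm_num : (0 : ℝ) < 1 / 10)
      (by norm_num : (1 / 10 : ℝ) ≤ 1) hgap h3 hlo hhi hβ0 hρA hd hd1 hd2 hBa hB hcG hr hY hκ₁ hκX hcN hM
      (Nat.one_le_iff_ne_zero.mpr (NeZero.ne M)) hMβ' hLz' hLΛ hΛβ ω ch
    refine h.trans (le_of_eq ?_)
    rw [imagTimeWeight, div_div_eq_mul_div]
    ring
  · -- INACTIVE scale: the multiplier vanishes
    have hlt : klScale klE0 m < π / β := klth_klScale_lt_pi_div hβ0 (by omega)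
    have h0 : ∀ k : FreqMomentum L M, klIsoFamily L M β μ K klE0 m ω k = 0 := fun k =>
      klIsoFamily_eq_zero_of_klScale_lt he hβ0 μ K hlt ω k
    simp only [h0, zero_mul, Finset.sum_const_zero, norm_zero, mul_zero]
    positivity

/-- **`T̂_iso` — the hypothesis `hT` of `EngineV8.isoTupleL1AtS_zero_of_klEng`, with ONE absolute constant.**  There are `κ₀ > 0` and
`T̂ > 0` such that for every renormalisation package `R` (`Gfr ≥ 0`), every regime constant `0 < c ≤ κ₀/(12(Gfr₂+1))`, coupling
`0 < U ≤ min 1 (κ₀/(24(Gfr₀+Gfr₁+1)))`, `klBetaMin ≤ β ≤ e^{c/U²}`, `μ ∈ klWindowC`, frame `FrameOK R U (nScales β) μ K`, cut-offs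
`β² ≤ L`, `β ≤ M`, and EVERY isotropic scale `m`, sector `ω` and charge `c`:
`(1/(|β|L²))·Σ_{dw}‖Σ_k klIsoFamily L M β μ K klE0 m ω k·Χ_c(k;dw)‖ ≤ T̂ / imagTimeWeight β M` (active scales `m ≤ n_β+1` by
`iso_torusSum_le_frame`, inactive ones by `klIsoFamily_eq_zero_of_klScale_lt`).  `T̂` is a closed term in the cutoff constants.
[cite: BenfattoGiulianiMastropietro2006, §2.6 (2.81), §2.8 (2.77)] -/
theorem iso_torusSum_of_frameOK :
    ∃ κ₀ : ℝ, 0 < κ₀ ∧ ∃ Th : ℝ, 0 < Th ∧ ∀ (R : RenConsts), (∀ j, 0 ≤ R.Gfr j) →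
      ∀ (c U : ℝ), 0 < c → c ≤ κ₀ / (12 * (R.Gfr 2 + 1)) → 0 < U → U ≤ min 1 (κ₀ / (24 * (R.Gfr 0 + R.Gfr 1 + 1))) →
      ∀ β : ℝ, klBetaMin ≤ β → β ≤ Real.exp (c / U ^ 2) → ∀ μ ∈ klWindowC, ∀ K : TrigPolyC4v, FrameOK R U (nScales β) μ K →
      ∀ (L M : ℕ) [NeZero L] [NeZero M], β ^ 2 ≤ (L : ℝ) → β ≤ (M : ℝ) →
      ∀ (m : ℕ) (ω : Fin (sectorCount (2 * m))) (ch : Fin 2),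
        1 / (|β| * (L : ℝ) ^ 2) * ∑ dw : TorusSite 1 (2 * (2 * M)) × TorusSite 2 L, ‖∑ k : FreqMomentum L M,
          klIsoFamily L M β μ K klE0 m ω k *
            (if ch = 0 then torusChar (fun _ : Fin 1 => ((k.1 : ℕ) : ZMod (2 * (2 * M)))) dw.1 * torusChar k.2 dw.2
              else conj (torusChar (fun _ : Fin 1 => ((k.1 : ℕ) : ZMod (2 * (2 * M)))) dw.1 * torusChar k.2 dw.2))‖ ≤
          Th / imagTimeWeight β M := by
  have ha : (-4 : ℝ) < -(6 / 5) := by norm_num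
  have hab : (-(6 / 5) : ℝ) ≤ -(1 / 10) := by norm_num
  have hb : (-(1 / 10) : ℝ) < 0 := by norm_num
  obtain ⟨Th, hTh, h⟩ := iso_torusSum_of_thresholds ha hab hb
  have hDt := (bandBounds ha hab hb).Dtmin_pos
  have hrh := (bandBounds ha hab hb).rhomin_pos
  exact ⟨_, lt_min (lt_min (by positivity) (by positivity)) (by norm_num), Th, hTh, h⟩

/-! ### §3 The engine's named target: `IsoTorusBoundAt` under the binders of `stub_engine_scale0` -/

/-- **`∃ T ≥ 0, IsoTorusBoundAt T`** — the isotropic torus bound under EXACTLY the binders of `stub_engine_scale0` (`P.WF`, `R.WF2`,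
`0 < c ≤ klEngC₃3 P R`, `μ ∈ klWindowC`, `0 < U ≤ klEngU₀3 P R c`, `klBetaMin ≤ β ≤ e^{c/U²}`, `FrameOK R U (nScales β) μ K`, `klEngL₃ β U ≤ L`,
`klEngM₃ β U L ≤ M`): the package thresholds are below the absolute ones (`klEngC₃3_le_symbolC₃`, `klEngU₀3_le_symbolU₀`), `Gfr ≥ 0` by
`R.WF2`, `β² ≤ L` / `β ≤ M` by `sq_le_of_klEngL₃_le` / `le_of_klEngM₃_le`. [cite: BenfattoGiulianiMastropietro2006, §2.6 (2.81)] -/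
theorem exists_isoTorusBoundAt : ∃ T : ℝ, 0 ≤ T ∧ EngineV8.IsoTorusBoundAt T := by
  have ha : (-4 : ℝ) < -(6 / 5) := by norm_num
  have hab : (-(6 / 5) : ℝ) ≤ -(1 / 10) := by norm_num
  have hb : (-(1 / 10) : ℝ) < 0 := by norm_num
  obtain ⟨Th, hTh, h⟩ := iso_torusSum_of_thresholds ha hab hb
  refine ⟨Th, hTh.le, ?_⟩
  intro P R c _ hR2 hc hc3 μ hμ U hU hU0 β hβmin hβc K hK L M _ _ hL3 hM3 m ω c'
  have hRj : ∀ j, 0 ≤ R.Gfr j := EngineV8.gfr_nonneg_of_wf2 hR2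
  exact h R hRj c U hc (hc3.trans (EngineV8.klEngC₃3_le_symbolC₃ ha hab hb P hRj)) hU
    (hU0.trans (EngineV8.klEngU₀3_le_symbolU₀ ha hab hb P hRj c)) β hβmin hβc μ hμ K hK L M
    (EngineV8.sq_le_of_klEngL₃_le hL3) (EngineV8.le_of_klEngM₃_le hβmin hL3 hM3) m ω c'

/-- **`IsoTorusBoundAt klIsoT`** — the engine's isotropic torus constant `klIsoT` (…EngineIsoTorusDefs) IS a bound: the hypothesis `hT`
of `EngineV8.isoTupleL1AtS_zero_of_klEng` / (E5-S)₀ of `stub_engine_scale0` is discharged. [cite: BenfattoGiulianiMastropietro2006, §2.6 (2.81)] -/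
theorem isoTorusBoundAt_klIsoT : EngineV8.IsoTorusBoundAt EngineV8.klIsoT := by
  obtain ⟨T, h0, h⟩ := exists_isoTorusBoundAt
  exact EngineV8.isoTorusBoundAt_klIsoT h0 h

end Summit.HubbardSuperconductivity.HubbardSuperconductivity.Theorems.TorusFourierL2

end
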